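import Summits.CriticalPhenomena.CardyFormulaZ2.Theorems.CardyDualCurrentMartingaleToSLE6Reduction
import HarnessLib

/-!
# RESTATEMENT proposal for route `CardyDualCurrent` (crux stmt-CriticalPhenomena-11395 `MartingaleToSLE6`)

Lead `prover-line-stmt-CriticalPhenomena-11395-0`, 2026-08-17 (companion of
`PROMOTE-stub_templateClockData.md`). NOTHING here is asserted; this file TYPES the restated support
item r9′ the planner is advised to file in place of `TemplateCanonicalLimit` (whose observable `G`
speaks of admissible `DiscreteDobrushin` data along families of Jordan domains only, and therefore
cannot feed the martingale identification at any conditioning step `n ≥ 1`, where the Doob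
martingale is a PINNED-data observable — `percSlitExpectation_eq_integral_pin`,
`not_isZdAdmissible_rendering_of_pin`, both landed), and certifies that with it r5′ is pure landed glue:

* `TemplateClockData` — r9′: "the Doob martingale of SOME finite-range local parafermionic template
  variable tracks the spin-1/3 half-plane observable along the capacity clocks": verbatim the sibling
  crux's `PercParaClockData` (stmt-11389, `…Reduction.lean`) with its existential variable `X`
  INSTANTIATED by the template integrand `Σ_j g i j (ω ∩ window) · passageSum (fkInterface (Λ δ_k) ω) …`
  at some lattice edge `(x, i)` (the edge, the filtration `𝒢`, the clock `θ`, the normalisation `c`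
  stay existential per scale, exactly as in `PercParaClockData`; by the domain Markov property the
  honest witnesses are the exploration filtration and `c ≍ θ_δ C δ^{-1/3} × (t-independent factor)`).
  This is DCS Conj. 8.7 for the template, Carathéodory-uniformly over the slit (= pinned) data met
  along the exploration, in the clock form the tree's q = 1 chain consumes.
* `percParaClockData_of_templateClockData : TemplateClockData → PercParaClockData` (repackaging).
* `sle6InterfaceLimit_of_percKSBoxData_of_templateClockData` — r5′ := `TemplateClockData →
  SLE6InterfaceLimit` holds modulo `PercKSBoxData` (better: `PercFaceBoxTight`, via
  `percKSBoxData_of_boxTight`) by the landed `sle6InterfaceLimit_of_percKSBoxData_of_percParaClockData`.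

The route's content then sits in r4′ := (exact CR for the template, with the Cauchy–Riemann
quantifier extended from admissible to pinned data) → `TemplateClockData` — Smirnov's theorem at
`σ = 1/3` in the form "uniformly over all `Ω^δ_n`" (DCS 2012 proof of Prop. 6.7; Smirnov 2010
Rem. 2.3; KS17 §4).
-/

noncomputable section

open scoped Topology NNReal ENNReal
open Filter Set MeasureTheory Metric
open UpperHalfPlane (upperHalfPlaneSet)
open Literature.Probability Literature.Probability.LatticeModels Literature.Probability.Percolation
open Literature.Probability.RandomPlanarGeometry
open scoped Literature.Probability.RandomPlanarGeometry.PathBorel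
open Summit.CriticalPhenomena.CardyFormulaZ2.Cruxes.ParafermionToSLESixFamilies.CaratheodoryNetSlitUniformity
  (Pc PercKSBoxData PercFaceBoxTight PercParaClockData paraObservableProcess)
open Summit.CriticalPhenomena.CardyFormulaZ2.Cruxes.ParafermionToSLESixFamilies.FaceKernel
  (percKSBoxData_of_boxTight)
open Summit.CriticalPhenomena.CardyFormulaZ2.Theses.CardyDualCurrent (SLE6InterfaceLimit)
open Summit.CriticalPhenomena.CardyFormulaZ2.Theorems
  (sle6InterfaceLimit_of_percKSBoxData_of_percParaClockData)

namespace Summit.CriticalPhenomena.CardyFormulaZ2.Cruxes.MartingaleToSLE6.Birth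

/-- The random variable of the finite-range local parafermionic template `(r, m, z, s, g)` at the
medial vertex of type `i` based at the site `x`, for the exploration interface of the discrete
Dobrushin datum `E` (the integrand of the route's observable `G E x i`; cf.
`Literature.Probability.LatticeModels.LocalParafermionicTemplate.obsUnder`). -/
def templateVar (r m : ℕ) (z : Fin 2 → Fin m → MedialVertex) (s : Fin 2 → Fin m → ℝ)
    (g : Fin 2 → Fin m → Set MedialVertex → ℂ) (E : DiscreteDobrushin) (x : Site 2) (i : Fin 2)
    (ω : BondConfig (Site 2)) : ℂ :=
  ∑ j, g i j {e | medialGraph.edist s((0 : Site 2), Pi.single i 1) e ≤ (r : ℕ∞) ∧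
      Sym2.map (· + x) e ∈ ω} *
    Literature.Probability.LatticeModels.passageSum (fkInterface E ω) E.δ (s i j) (Sym2.map (· + x) (z i j))

/-- **r9′ `TemplateClockData` (proposed restatement of `TemplateCanonicalLimit`).** There is a
finite-range local parafermionic template `(r, m, z, s, g)` (passage vertices in the medial ball
of radius `r`) such that, for every Dobrushin domain, discretisation family, chordal uniformizing
map `φ`, positive admissible meshes `δ_k → 0` and approximating Dobrushin domains `D_k` with
chordal maps `φ_k → φ` ((U1), (U2), `b_k → b`) carrying Kemppainen–Smirnov boxes, and every
`y > 0`, `s < t < T(iy)`: at every scale there are a filtration `𝒢`, an adapted capacity clock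
`θ`, a step bound `M`, a lattice edge `(x, i)`, a normalisation `c` and a small bad event such that
the Doob martingale `n ↦ c · E[X | 𝒢_n]` of the TEMPLATE VARIABLE `X = templateVar … (Λ δ_k) x i`
is bounded by `C` and within `ε_k → 0` of `paraObservableProcess (V^k) y (θ_n)` for `n ≤ M`,
`θ_n ≤ t + Δ_k`, the driving process `V^k = drivingFunction φ_k ∘ bondInterfaceIn D (Λ δ_k)`
being revealed by step `M` and local for `(𝒢, θ)` — verbatim `PercParaClockData` with its
existential `X` instantiated. (DCS 2012 Conj. 8.7 / proof of Prop. 6.7 "uniformly over all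
`Ω^δ_n`"; CDHKS 2014 §3; KS17 §4 — at `q = 1` for SOME template.) -/
def TemplateClockData : Prop :=
  ∃ (r m : ℕ) (z : Fin 2 → Fin m → MedialVertex) (s : Fin 2 → Fin m → ℝ)
    (g : Fin 2 → Fin m → Set MedialVertex → ℂ),
    (∀ i j, medialGraph.edist s((0 : Site 2), Pi.single i 1) (z i j) ≤ (r : ℕ∞)) ∧
  ∀ (D : DobrushinDomain) (Λ : ℝ → DiscreteDobrushin), ZdDiscretisationFamily D Λ →
    ∀ φ : ConformalEquiv upperHalfPlaneSet D.carrier, D.IsChordalUniformizing φ →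
    ∀ δs : ℕ → ℝ, (∀ k, 0 < δs k) → Tendsto δs atTop (𝓝 0) →
      (∀ k, (Λ (δs k)).IsZdAdmissible) →
    ∀ (Ds : ℕ → DobrushinDomain) (φs : ∀ k, ConformalEquiv upperHalfPlaneSet (Ds k).carrier),
      (∀ k, (Ds k).IsChordalUniformizing (φs k)) →
      (∀ R : ℝ, TendstoUniformlyOn (fun k ↦ (φs k).boundaryExtension) φ.boundaryExtension
        atTop ({z : ℂ | 0 ≤ z.im} ∩ closedBall 0 R)) →
      (∀ ε : ℝ, 0 < ε → ∃ r : ℝ, ∀ᶠ k in atTop, ∀ z : ℂ, z ∈ {z : ℂ | 0 ≤ z.im} → r ≤ ‖z‖ →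
        dist ((φs k).boundaryExtension z) ((Ds k).pt 1) ≤ ε) →
      Tendsto (fun k ↦ (Ds k).pt 1) atTop (𝓝 (D.pt 1)) →
      (∀ ε : ℝ≥0∞, 0 < ε → ∃ (δγ δW : ℕ → ℝ) (T : ℕ → ℝ≥0), (∀ j, 0 < δγ j) ∧
        (∀ j, 0 < δW j) ∧
        ∀ k, Pc ((bondInterfaceIn D (Λ (δs k))) ⁻¹'
          ((fun p ↦ compactifiedClass (φs k).boundaryExtension ((Ds k).pt 1) p.1) ''
            {p : C(ℝ≥0, ℂ) × C(ℝ≥0, ℝ) | p ∈ generatedPairs ∧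
              p.1 ∈ Process.modulusSet ({0} : Set ℂ) δγ ∧
              p.2 ∈ Process.modulusSet ({0} : Set ℝ) δW ∧
              ∀ (j : ℕ) (t : ℝ≥0), T j ≤ t → (j : ℝ) ≤ ‖p.1 t‖})ᶜ) ≤ ε) →
      ∀ y : ℝ, 0 < y → ∀ s' t : ℝ≥0, s' < t → t < Loewner.cdhksTime y →
        ∃ (C : ℝ) (ε Δ η : ℕ → ℝ≥0), Tendsto ε atTop (𝓝 0) ∧ Tendsto Δ atTop (𝓝 0) ∧
          Tendsto η atTop (𝓝 0) ∧
          ∀ k, ∃ (𝒢 : Filtration ℕ (inferInstance : MeasurableSpace (BondConfig (Site 2))))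
            (θ : ℕ → BondConfig (Site 2) → ℝ≥0) (M : ℕ) (x : Site 2) (i : Fin 2) (c : ℂ)
            (bad : Set (BondConfig (Site 2))),
            Adapted 𝒢 θ ∧ (∀ ω, ω ∉ bad → θ 0 ω ≤ Δ k) ∧
            (∀ u, Measurable[𝒢 M] fun ω ↦
              drivingFunction (φs k) (bondInterfaceIn D (Λ (δs k)) ω) u) ∧
            (∀ n u, Measurable[𝒢 n] ({ω | u ≤ θ n ω}.indicator fun ω ↦
              drivingFunction (φs k) (bondInterfaceIn D (Λ (δs k)) ω) u)) ∧
            (∀ᵐ ω ∂Pc, ∀ n, n ≤ M →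
              ‖c * Pc[templateVar r m z s g (Λ (δs k)) x i|𝒢 n] ω‖ ≤ C) ∧
            MeasurableSet bad ∧ Pc bad ≤ η k ∧
            (∀ ω, ω ∉ bad → ∃ n ≤ M, t ≤ θ n ω) ∧
            (∀ ω, ω ∉ bad → ∀ n, n < M → θ (n + 1) ω ≤ θ n ω + Δ k) ∧
            (∀ᵐ ω ∂Pc, ω ∉ bad → ∀ n, n ≤ M → θ n ω ≤ t + Δ k →
              ‖c * Pc[templateVar r m z s g (Λ (δs k)) x i|𝒢 n] ω -
                paraObservableProcess (fun u ω ↦ drivingFunction (φs k)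
                  (bondInterfaceIn D (Λ (δs k)) ω) u) y (θ n ω) ω‖ ≤ ε k)

/-- r9′ gives the sibling's `PercParaClockData` (instantiate its existential `X` with the template
variable). -/
theorem percParaClockData_of_templateClockData : TemplateClockData → PercParaClockData := by
  rintro ⟨r, m, z, s, g, -, h⟩ D Λ hΛ φ hφ δs hpos hlim hadm Ds φs hφs hU1 hU2 hb hbox y hy s' t hs't htT
  obtain ⟨C, ε, Δ, η, hε, hΔ, hη, hk⟩ :=
    h D Λ hΛ φ hφ δs hpos hlim hadm Ds φs hφs hU1 hU2 hb hbox y hy s' t hs't htT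
  refine ⟨C, ε, Δ, η, hε, hΔ, hη, fun k ↦ ?_⟩
  obtain ⟨𝒢, θ, M, x, i, c, bad, h1, h2, h3, h4, h5, h6, h7, h8, h9, h10⟩ := hk k
  exact ⟨𝒢, θ, M, templateVar r m z s g (Λ (δs k)) x i, c, bad, h1, h2, h3, h4, h5, h6, h7, h8, h9,
    h10⟩

/-- **r5′ modulo Kemppainen–Smirnov data**: `TemplateClockData → SLE6InterfaceLimit` from
`PercKSBoxData`, by the landed `sle6InterfaceLimit_of_percKSBoxData_of_percParaClockData`. -/
theorem sle6InterfaceLimit_of_percKSBoxData_of_templateClockData (hKS : PercKSBoxData)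
    (hT : TemplateClockData) : SLE6InterfaceLimit :=
  sle6InterfaceLimit_of_percKSBoxData_of_percParaClockData hKS
    (percParaClockData_of_templateClockData hT)

/-- The same from KS box tightness of the raw polyline (`PercFaceBoxTight`, K1 proved). -/
theorem sle6InterfaceLimit_of_percFaceBoxTight_of_templateClockData (hB : PercFaceBoxTight)
    (hT : TemplateClockData) : SLE6InterfaceLimit :=
  sle6InterfaceLimit_of_percKSBoxData_of_templateClockData (percKSBoxData_of_boxTight hB) hT

end Summit.CriticalPhenomena.CardyFormulaZ2.Cruxes.MartingaleToSLE6.Birth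

end
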